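import Summits.Ventures.PercRepro.RankLevelSetDepCount

/-!
# PercRepro — THE `U`-COUNT AT EVERY LEVEL `q` AND BOUNDED CORANK, WITH A FLAT BOUND (night-1, gen 4)

`proofs/NIGHT-1-C025-induction.md` §15.8. The level-`4` count of `RankLevelSetDepCount` at every level `q ≥ 2`: if every
circuit has `≥ 3` elements and every set of rank `≤ q` has `≤ f` points, then

  `#{B ⊆ E : r(B) = q, |B| ≤ d} ≤ C(n, q) + σ · Σ_{k=3}^{q+1} s_k · C(n, q + 1 − k)`,
  `σ = Σ_{j ≤ d − q − 1} C(f − q − 1, j)`, `s_k = #{k-element circuits}`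

(`ncard_eRk_eq_ncard_le_le`): a rank-`q` set with more than `q` elements is `C ∪ B' ∪ Z` with `C` a circuit of `k`
elements, `B'` a `(q + 1 − k)`-set disjoint from `C`, and `Z` inside `cl(C ∪ B') ∖ (C ∪ B')` — at most `f − q − 1`
points — with `|Z| ≤ d − q − 1` (`ncard_fibre_le'`). Axioms: standard.
-/

open scoped Matroid

namespace PercRepro

namespace Matroid

open Set

variable {α : Type} {M : _root_.Matroid α}

/-- **The fibre count, general form.** If `|U| = u` and `|F ∖ U| ≤ m`, the sets `B` with `U ⊆ B ⊆ F` and `|B| ≤ d`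
number at most `Σ_{j ≤ d − u} C(m, j)`. -/
theorem ncard_fibre_le' {U F : Set α} (hF : F.Finite) {u m : ℕ} (hU : U.ncard = u)
    (hFU : (F \ U).ncard ≤ m) (d : ℕ) :
    {B : Set α | U ⊆ B ∧ B ⊆ F ∧ B.ncard ≤ d}.ncard ≤ ∑ j ∈ Finset.range (d - u + 1), Nat.choose m j := by
  classical
  have hFUfin : (F \ U).Finite := hF.subset sdiff_subset
  set T := hFUfin.toFinset with hT
  have hTcoe : (T : Set α) = F \ U := Set.Finite.coe_toFinset _
  have hTcard : T.card ≤ m := by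
    rw [← Set.ncard_eq_toFinset_card _ hFUfin]; exact hFU
  have hmaps : ∀ B ∈ {B : Set α | U ⊆ B ∧ B ⊆ F ∧ B.ncard ≤ d},
      B \ U ∈ {Z : Set α | Z ⊆ (T : Set α) ∧ Z.ncard ≤ d - u} := by
    intro B hB
    have hBfin : B.Finite := hF.subset hB.2.1
    refine ⟨by rw [hTcoe]; exact sdiff_subset_sdiff_left hB.2.1, ?_⟩
    rw [ncard_sdiff hB.1 (hBfin.subset hB.1), hU]
    have := hB.2.2
    omega
  have hinj : InjOn (fun B => B \ U) {B : Set α | U ⊆ B ∧ B ⊆ F ∧ B.ncard ≤ d} := by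
    intro B hB B' hB' h
    simp only at h
    rw [← union_sdiff_cancel hB.1, h, union_sdiff_cancel hB'.1]
  calc {B : Set α | U ⊆ B ∧ B ⊆ F ∧ B.ncard ≤ d}.ncard
      ≤ {Z : Set α | Z ⊆ (T : Set α) ∧ Z.ncard ≤ d - u}.ncard :=
        ncard_le_ncard_of_injOn (fun B => B \ U) hmaps hinj
          ((T.finite_toSet.finite_subsets).subset (fun Z hZ => hZ.1))
    _ ≤ ∑ j ∈ Finset.range (d - u + 1), T.card.choose j := ncard_subsets_ncard_le T (d - u)
    _ ≤ ∑ j ∈ Finset.range (d - u + 1), Nat.choose m j := by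
        apply Finset.sum_le_sum
        intro j _
        exact Nat.choose_le_choose j hTcard

/-- **THE RANK-`q` SETS OF AT MOST `d` ELEMENTS**, when every circuit has `≥ 3` elements and every set of rank `≤ q`
has `≤ f` elements: `#{B ⊆ E : r(B) = q, |B| ≤ d} ≤ C(n, q) + σ · Σ_{k=3}^{q+1} s_k · C(n, q+1−k)` with
`σ = Σ_{j ≤ d−q−1} C(f−q−1, j)` and `s_k` the number of `k`-element circuits. -/
theorem ncard_eRk_eq_ncard_le_le (M : _root_.Matroid α) [M.Finite] (q f : ℕ)
    (hcirc : ∀ C, M.IsCircuit C → 3 ≤ C.encard)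
    (hflat : ∀ X ⊆ M.E, M.eRk X ≤ q → X.ncard ≤ f) (d : ℕ) :
    {B : Set α | B ⊆ M.E ∧ M.eRk B = q ∧ B.ncard ≤ d}.ncard ≤
      M.E.ncard.choose q +
        (∑ j ∈ Finset.range (d - (q + 1) + 1), Nat.choose (f - (q + 1)) j) *
          ∑ k ∈ Finset.Icc 3 (q + 1), {C | M.IsCircuit C ∧ C.ncard = k}.ncard * M.E.ncard.choose (q + 1 - k) := by
  classical
  set Ef := M.ground_finite.toFinset with hEf
  have hE : (Ef : Set α) = M.E := Set.Finite.coe_toFinset _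
  have hEcard : Ef.card = M.E.ncard := (Set.ncard_eq_toFinset_card _ M.ground_finite).symm
  set σ := ∑ j ∈ Finset.range (d - (q + 1) + 1), Nat.choose (f - (q + 1)) j with hσ
  set S := {B : Set α | B ⊆ M.E ∧ M.eRk B = q ∧ B.ncard ≤ d} with hS
  set S₁ := {B : Set α | B ⊆ (Ef : Set α) ∧ B.ncard = q} with hS₁
  set S₂ := {B : Set α | B ⊆ M.E ∧ M.eRk B = q ∧ q < B.ncard ∧ B.ncard ≤ d} with hS₂
  have hsplit : S ⊆ S₁ ∪ S₂ := by
    intro B hB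
    have hBfin : B.Finite := M.ground_finite.subset hB.1
    have hle : q ≤ B.ncard := by
      have := M.eRk_le_encard B
      rw [hB.2.1, ← hBfin.cast_ncard_eq] at this
      exact_mod_cast this
    rcases hle.lt_or_eq with h | h
    · exact Or.inr ⟨hB.1, hB.2.1, h, hB.2.2⟩
    · exact Or.inl ⟨by rw [hE]; exact hB.1, h.symm⟩
  have hS₁fin : S₁.Finite := (Ef.finite_toSet.finite_subsets).subset (fun B hB => hB.1)
  have hS₂fin : S₂.Finite := M.ground_finite.finite_subsets.subset (fun B hB => hB.1)
  have hS₁ : S₁.ncard = M.E.ncard.choose q := by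
    rw [hS₁, ncard_subsets_ncard_eq Ef q, hEcard]
  -- the circuits of each size, and the subsets of `E` of each size, as `Finset`s of `Set`s
  have hcircfin : ∀ k : ℕ, {C | M.IsCircuit C ∧ C.ncard = k}.Finite := fun k =>
    M.ground_finite.finite_subsets.subset (fun C hC => hC.1.subset_ground)
  set 𝒞 : ℕ → Finset (Set α) := fun k => (hcircfin k).toFinset with h𝒞
  set 𝓑 : ℕ → Finset (Set α) := fun j => (Ef.powersetCard j).image (fun s : Finset α => (s : Set α)) with h𝓑
  have h𝓑card : ∀ j, (𝓑 j).card ≤ M.E.ncard.choose j := by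
    intro j
    calc (𝓑 j).card ≤ (Ef.powersetCard j).card := Finset.card_image_le
      _ = Ef.card.choose j := Finset.card_powersetCard j Ef
      _ = M.E.ncard.choose j := by rw [hEcard]
  have h𝒞card : ∀ k, (𝒞 k).card = {C | M.IsCircuit C ∧ C.ncard = k}.ncard := fun k =>
    (Set.ncard_eq_toFinset_card _ (hcircfin k)).symm
  have hmem𝓑 : ∀ (j : ℕ) (B' : Set α), B' ⊆ M.E → B'.ncard = j → B' ∈ 𝓑 j := by
    intro j B' hB'E hB'
    have hB'fin : B'.Finite := M.ground_finite.subset hB'E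
    rw [h𝓑, Finset.mem_image]
    refine ⟨hB'fin.toFinset, ?_, by simp⟩
    rw [Finset.mem_powersetCard]
    refine ⟨?_, by rw [← Set.ncard_eq_toFinset_card B' hB'fin]; exact hB'⟩
    intro x hx
    rw [Set.Finite.mem_toFinset] at hx
    rw [hEf, Set.Finite.mem_toFinset]
    exact hB'E hx
  -- the pairs `(C, B')`: `|C| = k ∈ [3, q+1]`, `|B'| = q + 1 − k`, disjoint, `r(C ∪ B') ≤ q`
  set P : Finset (Set α × Set α) :=
    ((Finset.Icc 3 (q + 1)).biUnion (fun k => 𝒞 k ×ˢ 𝓑 (q + 1 - k))).filter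
      (fun p => Disjoint p.2 p.1 ∧ M.eRk (p.1 ∪ p.2) ≤ q) with hP
  -- the fibres
  have hFibfin : ∀ p : Set α × Set α,
      {B : Set α | p.1 ∪ p.2 ⊆ B ∧ B ⊆ M.closure (p.1 ∪ p.2) ∧ B.ncard ≤ d}.Finite := fun p =>
    M.ground_finite.finite_subsets.subset (fun B hB => hB.2.1.trans (M.closure_subset_ground _))
  set Tf : Finset (Set α) := P.biUnion (fun p => (hFibfin p).toFinset) with hTf
  -- every `B ∈ S₂` lies in some fibre
  have hex : ∀ B ∈ S₂, ∃ p ∈ P, B ∈ (hFibfin p).toFinset := by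
    intro B hB
    obtain ⟨C, B', hC, hCB, hB'B, hdisj, hcard, hBcl⟩ :=
      exists_circuit_extension_exact hB.1 hB.2.1 hB.2.2.1
    have hCfin : C.Finite := M.ground_finite.subset hC.subset_ground
    have hC3 : 3 ≤ C.ncard := by
      have := hcirc C hC
      rw [← hCfin.cast_ncard_eq] at this
      exact_mod_cast this
    have hCmem : C ∈ 𝒞 C.ncard := by
      rw [h𝒞, Set.Finite.mem_toFinset]; exact ⟨hC, rfl⟩
    have hB'mem : B' ∈ 𝓑 (q + 1 - C.ncard) := hmem𝓑 _ B' (hB'B.trans hB.1) (by omega)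
    have hrk : M.eRk (C ∪ B') ≤ q := by
      rw [← hB.2.1]; exact M.eRk_mono (union_subset hCB hB'B)
    refine ⟨(C, B'), ?_, ?_⟩
    · rw [hP, Finset.mem_filter]
      refine ⟨?_, hdisj, hrk⟩
      rw [Finset.mem_biUnion]
      refine ⟨C.ncard, ?_, ?_⟩
      · rw [Finset.mem_Icc]; omega
      · rw [Finset.mem_product]; exact ⟨hCmem, hB'mem⟩
    · rw [Set.Finite.mem_toFinset]
      exact ⟨union_subset hCB hB'B, hBcl, hB.2.2.2⟩
  have hS₂sub : S₂ ⊆ (Tf : Set (Set α)) := by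
    intro B hB
    obtain ⟨p, hp, hBp⟩ := hex B hB
    rw [Finset.mem_coe, hTf, Finset.mem_biUnion]
    exact ⟨p, hp, hBp⟩
  -- each fibre has at most `σ` members
  have hfib : ∀ p ∈ P, ((hFibfin p).toFinset).card ≤ σ := by
    intro p hp
    rw [hP, Finset.mem_filter] at hp
    obtain ⟨hpmem, hdisj, hrk⟩ := hp
    rw [Finset.mem_biUnion] at hpmem
    obtain ⟨k, hk, hpk⟩ := hpmem
    rw [Finset.mem_Icc] at hk
    rw [Finset.mem_product] at hpk
    obtain ⟨h1, h2⟩ := hpk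
    rw [h𝒞, Set.Finite.mem_toFinset] at h1
    rw [h𝓑, Finset.mem_image] at h2
    obtain ⟨s, hs, hs'⟩ := h2
    rw [Finset.mem_powersetCard] at hs
    have hp1E : p.1 ⊆ M.E := h1.1.subset_ground
    have hp2E : p.2 ⊆ M.E := by rw [← hs', ← hE]; exact Finset.coe_subset.2 hs.1
    have hp1fin : p.1.Finite := M.ground_finite.subset hp1E
    have hp2fin : p.2.Finite := M.ground_finite.subset hp2E
    have hp1c : p.1.ncard = k := h1.2
    have hp2c : p.2.ncard = q + 1 - k := by rw [← hs', Set.ncard_coe_finset]; exact hs.2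
    have hU : (p.1 ∪ p.2).ncard = q + 1 := by
      rw [ncard_union_eq hdisj.symm hp1fin hp2fin, hp1c, hp2c]
      omega
    have hUE : p.1 ∪ p.2 ⊆ M.E := union_subset hp1E hp2E
    have hFfin : (M.closure (p.1 ∪ p.2)).Finite :=
      M.ground_finite.subset (M.closure_subset_ground _)
    have hFf : (M.closure (p.1 ∪ p.2)).ncard ≤ f :=
      hflat _ (M.closure_subset_ground _) (by rw [M.eRk_closure_eq]; exact hrk)
    have hUF : p.1 ∪ p.2 ⊆ M.closure (p.1 ∪ p.2) := M.subset_closure _ hUE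
    have hFU : (M.closure (p.1 ∪ p.2) \ (p.1 ∪ p.2)).ncard ≤ f - (q + 1) := by
      rw [ncard_sdiff hUF (hFfin.subset hUF), hU]
      omega
    rw [← Set.ncard_eq_toFinset_card _ (hFibfin p)]
    exact ncard_fibre_le' hFfin hU hFU d
  -- the number of pairs
  have hPcard : P.card ≤
      ∑ k ∈ Finset.Icc 3 (q + 1), {C | M.IsCircuit C ∧ C.ncard = k}.ncard * M.E.ncard.choose (q + 1 - k) := by
    calc P.card ≤ ((Finset.Icc 3 (q + 1)).biUnion (fun k => 𝒞 k ×ˢ 𝓑 (q + 1 - k))).card :=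
          Finset.card_filter_le _ _
      _ ≤ ∑ k ∈ Finset.Icc 3 (q + 1), (𝒞 k ×ˢ 𝓑 (q + 1 - k)).card := Finset.card_biUnion_le
      _ ≤ ∑ k ∈ Finset.Icc 3 (q + 1), {C | M.IsCircuit C ∧ C.ncard = k}.ncard * M.E.ncard.choose (q + 1 - k) := by
          apply Finset.sum_le_sum
          intro k _
          rw [Finset.card_product, h𝒞card k]
          exact Nat.mul_le_mul_left _ (h𝓑card _)
  -- assemble
  have hTfcard : Tf.card ≤ σ *
      ∑ k ∈ Finset.Icc 3 (q + 1), {C | M.IsCircuit C ∧ C.ncard = k}.ncard * M.E.ncard.choose (q + 1 - k) := by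
    calc Tf.card ≤ ∑ p ∈ P, ((hFibfin p).toFinset).card := Finset.card_biUnion_le
      _ ≤ ∑ _p ∈ P, σ := Finset.sum_le_sum hfib
      _ = P.card * σ := by rw [Finset.sum_const, smul_eq_mul]
      _ ≤ _ := by rw [mul_comm]; exact Nat.mul_le_mul_left σ hPcard
  calc S.ncard ≤ (S₁ ∪ S₂).ncard := ncard_le_ncard hsplit (hS₁fin.union hS₂fin)
    _ ≤ S₁.ncard + S₂.ncard := ncard_union_le _ _
    _ ≤ M.E.ncard.choose q + Tf.card := by
        rw [hS₁]
        gcongr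
        rw [← Set.ncard_coe_finset]
        exact ncard_le_ncard hS₂sub Tf.finite_toSet
    _ ≤ _ := by gcongr

end Matroid

end PercRepro
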